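import Mathlib.Analysis.Fourier.LpSpace
import Mathlib.MeasureTheory.Function.L2Space
import Mathlib.Analysis.InnerProductSpace.Orthonormal
import Literature.NumberTheory.LFunctions.WeilExplicit
import HarnessLib

/-!
# Connes–Consani 2021: Weil positivity at the archimedean place and the Sonin trace — STATEMENT LAYER

Typed reproduction (statements only, hypotheses explicit, NO proof claimed, no axioms) of the main
theorem of A. Connes, C. Consani, *Weil positivity and trace formula, the archimedean place*,
Selecta Math. (N.S.) 27 (2021), Paper No. 77 (= arXiv:2006.13771) [bib: `ConnesConsani2021`], together
with the operator-theoretic objects it uses (the scaling representation `ϑ` of `ℝ₊*` on `L²(ℝ)_ev`,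
Sonin's space `S(1,1)` and the trace functional `Tr(ϑ(f) 𝐒)`), in the vocabulary of the tree's
`Literature/NumberTheory/LFunctions/WeilExplicit.lean` (additive variable `t = log x`; no parallel
vocabulary is opened).  Cell `pub-rhdoor` (motivic door), seat cc-2; honest framing: this is a
typed skeleton of PUBLISHED work for an autopsy of the Connes–Consani programme, not an RH statement.

## What is printed (arXiv v3 = Selecta version; page numbers of the arXiv text)

* **Theorem 1** (Intro, p. 4). "Let `g ∈ C_c^∞(ℝ₊*)` have support in the interval `[2^{-1/2}, 2^{1/2}]`
  and Fourier transform vanishing at `i/2` and `0`. Then `W_∞(g ∗ g*) ≥ Tr(ϑ(g) 𝐒 ϑ(g)*)`."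
* **Eq. (4) / Theorem 6.11, p. 4 and §6.7 p. 28** (numbering: the arXiv/Selecta text numbers
  statements within sections from §1 on; `Theorem 6.11` = the 11th numbered statement of §6 = the
  main theorem of §6.7, "Theorem (mainthmfine)" of the source; likewise below). "there exists a
  finite constant `c` (with `13 < c < 17`) such that, for any `g ∈ C_c^∞([2^{-1/2}, 2^{1/2}])` whose
  Fourier transform vanishes at `i/2` one has `W_∞(g ∗ g*) ≥ Tr(ϑ(g) 𝐒 ϑ(g)*) − c |ĝ(0)|²`"; §6.7
  gives `c = 4γ/log 2` with the numerical constant `γ ≈ 2.9436` of Lemma 6.10 (§6.7), and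
  Remark 6.12 (§6.7, after the proof) shows the best constant exceeds `13`.  The proof in §6 is
  COMPUTER-ASSISTED (discretisation `q → 1`, Toeplitz matrices, a finite-rank approximation `T` of the
  compact operator `𝐊_I`, numerically computed spectrum `λ_max = 1.05158, λ₂ = 0.686494, …`,
  perturbation bound `ε₁ ≈ 0.00122` via [Simon] Thm. 1.7); we record this, we do not grade it.
* **The objects** (all on p. 7, p. 15, p. 16, App. A–B pp. 30–31, App. E p. 34):
  `⟨ξ|η⟩ := ½ ∫_ℝ ξ̄ η = ∫₀^∞ ξ̄ η` on `L²(ℝ)_ev` (eq. (8), p. 7; antilinear in the first slot);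
  the unitary scaling representation `(ϑ(λ)ξ)(v) := λ^{-1/2} ξ(λ^{-1} v)` (eq. (40), §4 p. 15);
  `ϑ(f) := ∫ f(λ) ϑ(λ) d*λ` for `f ∈ C_c^∞(ℝ₊*)` (proof of Prop. 2.2 (iii), p. 10);
  the Fourier transform `𝔽_{e_ℝ}(ξ)(y) := ∫ ξ(x) e^{-2πixy} dx` (eq. (13), p. 7 — Mathlib's `𝓕`);
  **Sonin's space** (Definition 4.4, §4 p. 16)
  `S(α,β) := {ξ ∈ L²(ℝ)_ev | ξ(q) = 0 ∀ |q| ≤ α, 𝔽_{e_ℝ}(ξ)(p) = 0 ∀ |p| ≤ β}`, and `𝐒` = the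
  orthogonal projection of `L²(ℝ)_ev` onto the closed subspace `S(1,1)` (Thm. 4.7, §4 p. 18);
  the multiplicative Fourier transform `f̂(s) := ∫₀^∞ f(u) u^{-is} d*u` (App. A, p. 30), so that
  "`f̂(± i/2) = ∫ f(ρ) ρ^{±1/2} d*ρ`" (Intro p. 5) and `f̂(0) = ∫ f d*u`;
  convolution `(f ∗ g)(u) := ∫ f(v) g(u/v) d*v` and involution `f*(u) := \overline{f(u^{-1})}`
  (App. A eq. (77), p. 30); `W_v(f) := 𝒲_v(Δ^{-1/2} f)`, `Δ^{1/2} f(x) := x^{1/2} f(x)` (Intro p. 3),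
  `W_∞ := −W_ℝ`, with Bombieri's archimedean distribution
  `𝒲_ℝ(f) := (log 4π + γ) f(1) + ∫₁^∞ (f(x) + f♯(x) − (2/x) f(1)) dx/(x − x^{-1})`,
  `f♯(x) := x^{-1} f(x^{-1})` (App. B eqs. (81)–(83), p. 31, citing [EB] = Bombieri 2000).

## Dictionary with the tree (checked symbol by symbol; see `WeilExplicit` module docstring)

Write `f = g ∘ log` (`g : ℝ → ℂ` the additive avatar, `IsWeilTest g`).  Then
`Δ^{-1/2} f (x) = x^{-1/2} g(log x)` is Bombieri's `f`, so CC's `W_∞(f) = −𝒲_ℝ(Δ^{-1/2} f)` is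
LITERALLY `weilArchTermBombieri g` (`x = e^t`, `dx/(x − x^{-1}) = e^t dt /(2 sinh t)`); CC's
`f ∗ f*` is `weilConv g (weilReflect g)`; CC's support `[2^{-1/2}, 2^{1/2}]` is
`tsupport g ⊆ Icc (-(log 2)/2) ((log 2)/2)`; CC's `f̂(s)` is `mulFourier g s = weilMellin g (1/2 − is)`
(`mulFourier_eq_weilMellin`), in particular `f̂(i/2) = ĝ(1)`, `f̂(0) = ĝ(1/2)`, `f̂(−i/2) = ĝ(0)` in the
tree's `weilMellin` normalisation.

## How the trace is typed (design; elementary and equivalent)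

Mathlib has no trace-class theory for `L²(ℝ)` and no Bochner-integrated representation `ϑ(f)`; we do
not build them.  Instead we use the identity (for `f = g ∗ g*`, `B := ϑ(g)𝐒`):
`Tr(ϑ(g) 𝐒 ϑ(g)*) = Tr(B B*) = Tr(B* B) = Tr(𝐒 ϑ(g* ∗ g) 𝐒) = Σ_{e ∈ ONB of S(1,1)} ⟨e | ϑ(f) e⟩`
`= sup { Σ_i ⟨ξ_i | ϑ(f) ξ_i⟩ : (ξ_i) a finite orthonormal family in S(1,1) }`
(`ℝ₊*` is abelian so `g* ∗ g = g ∗ g*`; `𝐒 ϑ(f) 𝐒 ≥ 0` vanishes on `S(1,1)^⊥`; each term is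
`‖𝐒 ϑ(g)* ξ_i‖² ≥ 0`), and `⟨ξ | ϑ(f) ξ⟩ = ∫ f(λ) ⟨ξ | ϑ(λ) ξ⟩ d*λ = ∫_ℝ k(τ) ⟨ξ | ϑ(e^τ) ξ⟩ dτ`
with `k = f ∘ exp` and `⟨ξ | ϑ(e^τ) ξ⟩ = ∫ ξ̄(v) e^{-τ/2} ξ(e^{-τ} v) dv` — honest Lebesgue integrals
of `L²` functions (`scalingCoeff`, `soninTraceForm`).  The factor `½` in CC's inner product on
`L²(ℝ)_ev` versus Mathlib's `∫_ℝ` is immaterial: a Mathlib-orthonormal family is `√2⁻¹` times a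
CC-orthonormal one and the matrix coefficient scales by `2`, so each sum `Σ_i ⟨ξ_i|ϑ(f)ξ_i⟩` is the
same number in both normalisations.  Hence "`W_∞(g ∗ g*) ≥ Tr(ϑ(g)𝐒ϑ(g)*)`" is EQUIVALENT to the
`∀ (finite orthonormal family in S(1,1))` inequality typed below, which needs only `L²(ℝ)`
(`MeasureTheory.Lp ℂ 2`), Mathlib's `L²` Fourier transform (`MeasureTheory.Lp.fourierTransformₗᵢ`,
notation `𝓕`) for Sonin's space, and `Orthonormal`.  Evenness is part of `soninSpace` (Def. 4.4 places
`S(α,β)` inside `L²(ℝ)_ev`).  The theorem's two sides are real; we compare real parts.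

## Deliberately NOT here

Theorem 3 / Thm. 4.7 (the trace formula `Tr(ϑ(f)𝐒) = W_∞(f) + ∫ f ε d*ρ` with `ε` a series of
prolate-spheroidal matrix coefficients), Corollary 2 (the zero-sum form, a consequence of Thm. 1 and
the explicit formula `Literature.NumberTheory.LFunctions.explicit_formula`), the operators `P`, `P̂`,
`u_∞`, the quantized calculus, and any numerics.  Yoshida's plain positivity on the same support is the
tree's `Literature.NumberTheory.LFunctions.weilPositivityOn_log_two_half`.
-/

noncomputable section

open _root_.MeasureTheory Complex Set FourierTransform
open scoped Real ComplexConjugate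

namespace Literature.NumberTheory.ConnesConsani2021

open Literature.NumberTheory.LFunctions

/-! ## Test-function side: CC's multiplicative Fourier transform in the additive variable -/

/-- Connes–Consani's (multiplicative) Fourier transform `f̂(s) := ∫₀^∞ f(u) u^{-is} d*u`
(App. A, p. 30; complex `s` allowed), written for the additive avatar `g = f ∘ exp`:
`f̂(s) = ∫_ℝ g(t) e^{-ist} dt`.  Equals `weilMellin g (1/2 − is)` (`mulFourier_eq_weilMellin`).
[cite: ConnesConsani2021, App. A p. 30] -/
def mulFourier (g : ℝ → ℂ) (s : ℂ) : ℂ :=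
  ∫ t : ℝ, g t * cexp (-(I * s * t))

/-- Dictionary: CC's `f̂(s)` is the tree's `ĝ(1/2 − is)` (`weilMellin g z = ∫ g(t) e^{(z−1/2)t} dt`).
[cite: ConnesConsani2021, App. A eq. (79) p. 30] -/
theorem mulFourier_eq_weilMellin (g : ℝ → ℂ) (s : ℂ) :
    mulFourier g s = weilMellin g (1 / 2 - I * s) := by
  simp only [mulFourier, weilMellin]
  refine integral_congr_ae (Filter.Eventually.of_forall fun t => ?_)
  ring_nf

/-- The vanishing condition "Fourier transform vanishing at `i/2`", `f̂(i/2) = ∫ f(ρ) ρ^{1/2} d*ρ = 0`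
(Intro p. 5), is `ĝ(1) = 0` in the tree's normalisation. [cite: ConnesConsani2021, Intro p. 5] -/
theorem mulFourier_I_half (g : ℝ → ℂ) : mulFourier g (I / 2) = weilMellin g 1 := by
  rw [mulFourier_eq_weilMellin]
  congr 1
  ring_nf
  rw [I_sq]
  ring

/-- `f̂(−i/2) = ∫ f(ρ) ρ^{-1/2} d*ρ` (Thm. 6.11 hypothesis, §6.7 p. 28) is `ĝ(0)`.
[cite: ConnesConsani2021, §6.7 p. 28] -/
theorem mulFourier_neg_I_half (g : ℝ → ℂ) : mulFourier g (-(I / 2)) = weilMellin g 0 := by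
  rw [mulFourier_eq_weilMellin]
  congr 1
  ring_nf
  rw [I_sq]
  ring

/-- `f̂(0) = ∫ f d*u` is `ĝ(1/2) = ∫ g` (evaluation at `0` is a character of the convolution algebra,
Intro p. 4). [cite: ConnesConsani2021, Intro p. 4] -/
theorem mulFourier_zero (g : ℝ → ℂ) : mulFourier g 0 = weilMellin g (1 / 2) := by
  rw [mulFourier_eq_weilMellin]
  simp

/-- CC's archimedean functional `W_∞(f) := −W_ℝ(f) = −𝒲_ℝ(Δ^{-1/2} f)` in the unitary normalisation
(Intro p. 3; App. B eqs. (81)–(83) p. 31, Bombieri's form of `𝒲_ℝ`): for `f = g ∘ exp` this is, symbol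
by symbol, the tree's `weilArchTermBombieri g` (module docstring, Dictionary).  An `abbrev`, not a new
notion. [cite: ConnesConsani2021, App. B eqs. (81)–(83) p. 31] -/
abbrev archW (g : ℝ → ℂ) : ℂ := weilArchTermBombieri g

/-! ## Hilbert-space side: `L²(ℝ)`, the scaling representation, Sonin's space -/

/-- The matrix coefficient `⟨ξ | ϑ(e^τ) η⟩` of the unitary scaling representation
`(ϑ(λ)η)(v) := λ^{-1/2} η(λ^{-1} v)` of `ℝ₊*` on `L²(ℝ)` (§4 eq. (40), p. 15), at `λ = e^τ`, in
Mathlib's inner product `∫_ℝ ξ̄ η` (antilinear in the first slot, as in CC eq. (8) p. 7 up to their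
factor `½` on even functions — see the module docstring for why the factor is immaterial).  Plain
functions; used on (representatives of) `L²` classes, on which it is well defined since dilations
preserve null sets. [cite: ConnesConsani2021, §4 eq. (40) p. 15] -/
def scalingCoeff (ξ η : ℝ → ℂ) (τ : ℝ) : ℂ :=
  ∫ v : ℝ, conj (ξ v) * ((Real.exp (-τ / 2) : ℂ) * η (Real.exp (-τ) * v))

/-- The diagonal coefficient of `ϑ(f) = ∫ f(λ) ϑ(λ) d*λ` (proof of Prop. 2.2 (iii), p. 10):
`⟨ξ | ϑ(f) ξ⟩ = ∫_ℝ k(τ) ⟨ξ | ϑ(e^τ) ξ⟩ dτ`, `k = f ∘ exp` the additive avatar (`d*λ = dτ`).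
For `f = g ∗ g*` and `ξ ∈ S(1,1)` this is the term `‖𝐒 ϑ(g)* ξ‖²` of the Sonin trace
`Tr(ϑ(g) 𝐒 ϑ(g)*)` (module docstring). [cite: ConnesConsani2021, Prop. 2.2 (iii) p. 10] -/
def soninTraceForm (k : ℝ → ℂ) (ξ : ℝ → ℂ) : ℂ :=
  ∫ τ : ℝ, k τ * scalingCoeff ξ ξ τ

/-- Pull-back of an a.e. equality along `x ↦ −x` (Lebesgue measure is reflection invariant).
[folklore] -/
private theorem ae_eq_comp_neg {f g : ℝ → ℂ} (h : f =ᵐ[volume] g) :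
    (fun x : ℝ => f (-x)) =ᵐ[volume] fun x : ℝ => g (-x) :=
  (Measure.measurePreserving_neg (volume : Measure ℝ)).quasiMeasurePreserving.ae_eq_comp h

/-- **Sonin's space** `S(α, β) ⊆ L²(ℝ)_ev` (Definition 4.4, §4 p. 16):
`S(α,β) := {ξ ∈ L²(ℝ)_ev | ξ(q) = 0 ∀ q, |q| ≤ α, (𝔽_{e_ℝ} ξ)(p) = 0 ∀ p, |p| ≤ β}`, with
`𝔽_{e_ℝ}(ξ)(y) = ∫ ξ(x) e^{-2πixy} dx` (eq. (13) p. 7) = Mathlib's `L²` Fourier transform `𝓕`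
(`MeasureTheory.Lp.fourierTransformₗᵢ`, same kernel `e^{-2πi⟨x,y⟩}`).  Typed as a `ℂ`-submodule of
`L²(ℝ) = Lp ℂ 2 volume`: even a.e., zero a.e. on `[-α, α]`, Fourier transform zero a.e. on `[-β, β]`
("vanish identically in the interval", Intro p. 3).  For `α = β = 1` this is the infinite-dimensional
space of N. Sonin (1880); `𝐒` is the orthogonal projection onto `S(1,1)` (it is closed: Thm. 4.7 p. 18).
[cite: ConnesConsani2021, Def. 4.4 §4 p. 16] -/
def soninSpace (α β : ℝ) : Submodule ℂ (Lp ℂ 2 (volume : Measure ℝ)) where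
  carrier := {ξ | (∀ᵐ x : ℝ, (ξ : ℝ → ℂ) (-x) = (ξ : ℝ → ℂ) x) ∧
    (∀ᵐ x : ℝ, x ∈ Icc (-α) α → (ξ : ℝ → ℂ) x = 0) ∧
    (∀ᵐ p : ℝ, p ∈ Icc (-β) β →
      ((𝓕 ξ : Lp ℂ 2 (volume : Measure ℝ)) : ℝ → ℂ) p = 0)}
  zero_mem' := by
    have h0 := Lp.coeFn_zero ℂ 2 (volume : Measure ℝ)
    have hF : (𝓕 (0 : Lp ℂ 2 (volume : Measure ℝ)) : Lp ℂ 2 (volume : Measure ℝ)) = 0 :=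
      fourier_zero
    refine ⟨?_, ?_, ?_⟩
    · filter_upwards [h0, ae_eq_comp_neg h0] with x hx hx'
      rw [hx', hx, Pi.zero_apply, Pi.zero_apply]
    · filter_upwards [h0] with x hx _
      rw [hx]; rfl
    · rw [hF]
      filter_upwards [h0] with p hp _
      rw [hp]; rfl
  add_mem' := by
    intro ξ η hξ hη
    obtain ⟨h1, h2, h3⟩ := hξ
    obtain ⟨k1, k2, k3⟩ := hη
    have ha := Lp.coeFn_add ξ η
    have hFa : (𝓕 (ξ + η) : Lp ℂ 2 (volume : Measure ℝ)) = 𝓕 ξ + 𝓕 η := fourier_add ξ η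
    refine ⟨?_, ?_, ?_⟩
    · filter_upwards [ha, ae_eq_comp_neg ha, h1, k1] with x hx hx' e1 e2
      rw [hx', hx, Pi.add_apply, Pi.add_apply, e1, e2]
    · filter_upwards [ha, h2, k2] with x hx e1 e2 hxI
      rw [hx, Pi.add_apply, e1 hxI, e2 hxI, add_zero]
    · rw [hFa]
      filter_upwards [Lp.coeFn_add (𝓕 ξ : Lp ℂ 2 (volume : Measure ℝ)) (𝓕 η), h3, k3]
        with p hp e1 e2 hpI
      rw [hp, Pi.add_apply, e1 hpI, e2 hpI, add_zero]
  smul_mem' := by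
    intro c ξ hξ
    obtain ⟨h1, h2, h3⟩ := hξ
    have hs := Lp.coeFn_smul c ξ
    have hFs : (𝓕 (c • ξ) : Lp ℂ 2 (volume : Measure ℝ)) = c • 𝓕 ξ := fourier_smul c ξ
    refine ⟨?_, ?_, ?_⟩
    · filter_upwards [hs, ae_eq_comp_neg hs, h1] with x hx hx' e1
      rw [hx', hx, Pi.smul_apply, Pi.smul_apply, e1]
    · filter_upwards [hs, h2] with x hx e1 hxI
      rw [hx, Pi.smul_apply, e1 hxI, smul_zero]
    · rw [hFs]
      filter_upwards [Lp.coeFn_smul c (𝓕 ξ : Lp ℂ 2 (volume : Measure ℝ)), h3] with p hp e1 hpI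
      rw [hp, Pi.smul_apply, e1 hpI, smul_zero]

/-- Unfolding `soninSpace` membership (the three printed conditions). [folklore] -/
theorem mem_soninSpace_iff (α β : ℝ) (ξ : Lp ℂ 2 (volume : Measure ℝ)) :
    ξ ∈ soninSpace α β ↔
      (∀ᵐ x : ℝ, (ξ : ℝ → ℂ) (-x) = (ξ : ℝ → ℂ) x) ∧
      (∀ᵐ x : ℝ, x ∈ Icc (-α) α → (ξ : ℝ → ℂ) x = 0) ∧
      (∀ᵐ p : ℝ, p ∈ Icc (-β) β →
        ((𝓕 ξ : Lp ℂ 2 (volume : Measure ℝ)) : ℝ → ℂ) p = 0) :=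
  Iff.rfl

/-- Sonin spaces decrease as the vanishing windows grow: `S(α', β') ⊆ S(α, β)` for `α ≤ α'`,
`β ≤ β'` (immediate from Definition 4.4). [cite: ConnesConsani2021, Def. 4.4 §4 p. 16] -/
theorem soninSpace_antitone {α α' β β' : ℝ} (hα : α ≤ α') (hβ : β ≤ β') :
    soninSpace α' β' ≤ soninSpace α β := by
  rintro ξ ⟨h1, h2, h3⟩
  refine ⟨h1, ?_, ?_⟩
  · filter_upwards [h2] with x hx hxI
    exact hx (Icc_subset_Icc (neg_le_neg hα) hα hxI)
  · filter_upwards [h3] with q hq hqI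
    exact hq (Icc_subset_Icc (neg_le_neg hβ) hβ hqI)

/-! ## The statements -/

/-- **Connes–Consani 2021, Theorem 1** (Intro p. 4; NAMED FACT, no proof claimed).  As printed:
"Let `g ∈ C_c^∞(ℝ₊*)` have support in the interval `[2^{-1/2}, 2^{1/2}]` and Fourier transform
vanishing at `i/2` and `0`.  Then `W_∞(g ∗ g*) ≥ Tr(ϑ(g) 𝐒 ϑ(g)*)`."  Typed (module docstring,
"How the trace is typed"): for every such `g` (additive avatar, `IsWeilTest g`,
`tsupport g ⊆ [-(log 2)/2, (log 2)/2]`, `f̂(i/2) = 0`, `f̂(0) = 0`) and every finite orthonormal family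
`ξ₁, …, ξₙ` of `L²(ℝ)` lying in Sonin's space `S(1,1)`,
`Σ_i Re ⟨ξ_i | ϑ(g ∗ g*) ξ_i⟩ ≤ Re W_∞(g ∗ g*)`, i.e. every partial sum of the Sonin trace is bounded
by the archimedean Weil functional; equivalently `Tr(ϑ(g)𝐒ϑ(g)*) ≤ W_∞(g ∗ g*)`.  The proof in print
is computer-assisted (§6).  RIGOUR STATUS OF THE PRINTED PROOF (literature audit 2026-08-20, cell
`pub-rhdoor`, `HOME/lit/CC2021-RIGOUR-MAP.md`): an analytic reduction (§2–§5, App. E) to spectral data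
of one compact operator `𝐊_I` on `L²([−½ log 2, ½ log 2])`, evaluated in §6 by FLOATING-POINT
computation — Lemma 5.4 (`ε′(1₊)` "of the order of 22.9965"; reproduced in-house by a 60-digit
Legendre–Galerkin prolate computation as `22.99647568…`), Fact 6.1 ("the proof is a computer
calculation of the `L¹` norm": `‖𝐊_I − T‖ ≤ ε₁ ≈ 0.00122` for a finite-rank `T` specified by
supplementary numerical tables, pp. 23–24), Fact 6.5, Lemma 6.8 (ii)–(iii) (eigenvalues of
`N = 2000` and `N = 10⁴` matrices, `λ₂(T) ≤ 0.772216`); no interval arithmetic is claimed in print.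
From the printed constants, this Theorem 1 (the case `ĝ(0) = 0`) holds with an operator-norm margin
`≈ 0.2` on `η₀^⊥` against the tolerance `ε₁ ≈ 0.0012` (numerically robust; what is missing for a
certified proof is certification, not precision).  An independent in-house floating-point computation
of the spectrum of `𝐊_I` itself, built directly from the prolate formulas of Lemma 5.2 / Prop. 5.3
without the authors' supplementary tables (Nyström discretisation; `HOME/lit/data/`), gives
`1.051555, 0.686509, 0.028753` for the three leading eigenvalues (printed for `T`: `1.05158, 0.686494,
0.0288921`, all differences `< ε₁`), a margin `≈ 0.31` for this Theorem 1 on `η₀^⊥`, and `≈ 15.2` for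
the optimal constant of eq. (4) (printed bracket `13 < c < 17`); none of these computations, ours or the
source's, is interval-certified.  Yoshida's plain positivity on this support is
`Literature.NumberTheory.LFunctions.weilPositivityOn_log_two_half`; this is a strictly stronger
inequality on the codimension-2 subspace `f̂(i/2) = f̂(0) = 0`.
[cite: ConnesConsani2021, Thm. 1 (Intro p. 4); Thm. 6.11 §6.7 p. 28] -/
def WeilArchPositivity_soninTrace : Prop :=
  ∀ g : ℝ → ℂ, IsWeilTest g →
    tsupport g ⊆ Icc (-(Real.log 2 / 2)) (Real.log 2 / 2) →
    mulFourier g (I / 2) = 0 → mulFourier g 0 = 0 →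
    ∀ (n : ℕ) (ξ : Fin n → Lp ℂ 2 (volume : Measure ℝ)),
      Orthonormal ℂ ξ → (∀ i, ξ i ∈ soninSpace 1 1) →
        ∑ i, (soninTraceForm (weilConv g (weilReflect g)) (ξ i : ℝ → ℂ)).re
          ≤ (archW (weilConv g (weilReflect g))).re

/-- **Connes–Consani 2021, eq. (4) / Theorem 6.11** (Intro p. 4, §6.7 p. 28; NAMED FACT, no proof
claimed).  As printed (Intro): "there exists a finite constant `c` (with `13 < c < 17`) such that, for any
`g ∈ C_c^∞([2^{-1/2}, 2^{1/2}])` whose Fourier transform vanishes at `i/2` (`ĝ(i/2) = 0`) one has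
`W_∞(g ∗ g*) ≥ Tr(ϑ(g) 𝐒 ϑ(g)*) − c |ĝ(0)|²`."  Theorem 6.11 gives `c = 4γ/log 2 < 17` with the
numerical `γ ≈ 2.9436` of Lemma 6.10 (and states the vanishing at `−i/2`, which is the same statement
for `g*` since `W_∞(g ∗ g*)`, the Sonin trace and `|ĝ(0)|` are invariant under `g ↦ g*`); the lower
bound `13 < c_best` (Remark 6.12) is about the OPTIMAL constant and is not part of the existence claim,
so we type `∃ c < 17`.  Same weak-trace typing as `WeilArchPositivity_soninTrace`.  RIGOUR STATUS
(literature audit 2026-08-20, see `WeilArchPositivity_soninTrace`): `c = 4γ/log 2 = 8aε′(1₊)/log 2`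
evaluates to `≈ 16.99` at the printed `a ≃ 0.064`, `ε′(1₊) ≃ 22.9965` (Lemma 6.10), i.e. `0.08 %`
below the Intro's bound `17`; with the smallest `a` admissible in Lemma 6.9–6.10 (`a ≈ 0.060`) it is
`≈ 16.0`, so the existence of some `c < 17` tolerates roughly a factor `3.6` in `ε₁` or `6 %` in
`ε′(1₊)` (floating-point inputs, uncertified in print); Remark 6.12's `13 < c_best` uses
`0.1 · ε′(1₊) · 4/log 2 ≈ 13.27`.
[cite: ConnesConsani2021, eq. (4) p. 4; Thm. 6.11 §6.7 p. 28] -/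
def WeilArchPositivity_soninTrace_fine : Prop :=
  ∃ c : ℝ, c < 17 ∧
    ∀ g : ℝ → ℂ, IsWeilTest g →
      tsupport g ⊆ Icc (-(Real.log 2 / 2)) (Real.log 2 / 2) →
      mulFourier g (I / 2) = 0 →
      ∀ (n : ℕ) (ξ : Fin n → Lp ℂ 2 (volume : Measure ℝ)),
        Orthonormal ℂ ξ → (∀ i, ξ i ∈ soninSpace 1 1) →
          ∑ i, (soninTraceForm (weilConv g (weilReflect g)) (ξ i : ℝ → ℂ)).re
              - c * ‖mulFourier g 0‖ ^ 2
            ≤ (archW (weilConv g (weilReflect g))).re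

/-- Theorem 1 is the case `ĝ(0) = 0` of eq. (4) ("Since the evaluation of the Fourier transform at `0`
defines a character of the convolution algebra, it follows that …", Intro p. 4).  PROVED implication
between the two typed statements (so the tree carries one independent fact here, not two).
[cite: ConnesConsani2021, Intro p. 4] -/
theorem weilArchPositivity_soninTrace_of_fine (h : WeilArchPositivity_soninTrace_fine) :
    WeilArchPositivity_soninTrace := by
  obtain ⟨c, -, hc⟩ := h
  intro g hg hsupp h1 h0 n ξ hξ hS
  have key := hc g hg hsupp h1 n ξ hξ hS
  rw [h0, norm_zero] at key
  simpa using key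

/-! ## The involution `g ↦ g*` and the two printed vanishing conventions (`i/2` vs `−i/2`)

Theorem 6.11 (§6.7 p. 28) is PRINTED with the hypothesis "Fourier transform vanishes at `−i/2`",
the Introduction's eq. (4) (p. 4) with "vanishes at `i/2`".  App. A (p. 30) records that the
multiplicative Fourier transform "transforms convolution into pointwise product and the involution
into the pointwise complex conjugation, `s ∈ ℝ`"; for complex `s` the exact relation is
`(g*)^(s) = conj ĝ(s̄)` (`mulFourier_weilReflect`), so `(g*)^(i/2) = conj ĝ(−i/2)` and
`|(g*)^(0)| = |ĝ(0)|`, while `g* ∗ (g*)* = g* ∗ g = g ∗ g*` (the convolution algebra of `ℝ₊*` is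
commutative).  Hence the two printed forms are the SAME statement up to renaming `g ↦ g*`; this is
`weilArchPositivity_soninTrace_fine_iff_neg_I_half` below (PROVED; closes the cell referee's audit
row B5, which had this symmetry "argued in the docstring, not formalised"). -/

/-- Commutativity of the additive convolution `weilConv` (Mathlib `convolution_flip`; the group `ℝ`
is abelian and `ContinuousLinearMap.mul ℂ ℂ` is its own flip). [folklore] -/
private theorem weilConv_comm (f g : ℝ → ℂ) : weilConv f g = weilConv g f := by
  have h := convolution_flip (L := ContinuousLinearMap.mul ℂ ℂ) (μ := (volume : Measure ℝ))
    (f := f) (g := g)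
  rw [ContinuousLinearMap.flip_mul] at h
  exact h.symm

/-- The involution `g*(t) = conj g(−t)` is involutive. [folklore] -/
private theorem weilReflect_weilReflect (g : ℝ → ℂ) : weilReflect (weilReflect g) = g := by
  funext t
  simp [weilReflect]

/-- `g* ∗ (g*)* = g ∗ g*` (involutivity and commutativity of the convolution; this is the identity
`g* ∗ g = g ∗ g*` used in "How the trace is typed"). [folklore] -/
private theorem weilConv_weilReflect_weilReflect (g : ℝ → ℂ) :
    weilConv (weilReflect g) (weilReflect (weilReflect g)) = weilConv g (weilReflect g) := by
  rw [weilReflect_weilReflect, weilConv_comm]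

/-- `tsupport g* = −tsupport g`. [folklore] -/
private theorem tsupport_weilReflect_eq_neg (g : ℝ → ℂ) :
    tsupport (weilReflect g) = -tsupport g := by
  have h : Function.support (weilReflect g) = -Function.support g := by
    ext t; simp [weilReflect]
  simp only [tsupport, h, neg_closure]

/-- The symmetric support window `[−a, a]` is stable under `g ↦ g*`. [folklore] -/
private theorem tsupport_weilReflect_subset_Icc {g : ℝ → ℂ} {a : ℝ} (h : tsupport g ⊆ Icc (-a) a) :
    tsupport (weilReflect g) ⊆ Icc (-a) a := by
  rw [tsupport_weilReflect_eq_neg]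
  intro t ht
  have ht' : -t ∈ Icc (-a) a := h (by simpa using ht)
  simp only [mem_Icc] at ht' ⊢
  constructor <;> linarith [ht'.1, ht'.2]

/-- **Involution vs. multiplicative Fourier transform** (App. A p. 30: the transform turns "the
involution into the pointwise complex conjugation, `s ∈ ℝ`"; for complex `s` the evaluation "is still
multiplicative but no longer compatible with the involution").  The exact relation for all complex
`s`: `(g*)^(s) = conj (ĝ(s̄))`. [cite: ConnesConsani2021, App. A p. 30] -/
theorem mulFourier_weilReflect (g : ℝ → ℂ) (s : ℂ) :
    mulFourier (weilReflect g) s = conj (mulFourier g (conj s)) := by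
  simp only [mulFourier, weilReflect]
  have h1 : (∫ t : ℝ, conj (g (-t)) * cexp (-(I * s * (t : ℂ)))) =
      ∫ t : ℝ, conj (g t) * cexp (I * s * (t : ℂ)) := by
    rw [← integral_neg_eq_self (fun t : ℝ => conj (g t) * cexp (I * s * (t : ℂ))) volume]
    refine integral_congr_ae (Filter.Eventually.of_forall fun t => ?_)
    simp only [Complex.ofReal_neg, mul_neg]
  have h2 : conj (∫ t : ℝ, g t * cexp (-(I * conj s * (t : ℂ)))) =
      ∫ t : ℝ, conj (g t) * cexp (I * s * (t : ℂ)) := by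
    rw [← integral_conj]
    refine integral_congr_ae (Filter.Eventually.of_forall fun t => ?_)
    simp only [map_mul, ← Complex.exp_conj, map_neg, Complex.conj_conj, Complex.conj_I,
      Complex.conj_ofReal]
    ring_nf
  rw [h1, h2]

/-- `(g*)^(i/2) = conj ĝ(−i/2)`: the Intro's vanishing condition for `g*` is Theorem 6.11's for `g`.
[cite: ConnesConsani2021, Intro p. 4; Thm. 6.11 §6.7 p. 28] -/
theorem mulFourier_weilReflect_I_half (g : ℝ → ℂ) :
    mulFourier (weilReflect g) (I / 2) = conj (mulFourier g (-(I / 2))) := by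
  rw [mulFourier_weilReflect]
  congr 2
  rw [map_div₀, Complex.conj_I, map_ofNat, neg_div]

/-- `(g*)^(−i/2) = conj ĝ(i/2)`. [cite: ConnesConsani2021, Intro p. 4; Thm. 6.11 §6.7 p. 28] -/
theorem mulFourier_weilReflect_neg_I_half (g : ℝ → ℂ) :
    mulFourier (weilReflect g) (-(I / 2)) = conj (mulFourier g (I / 2)) := by
  rw [mulFourier_weilReflect]
  congr 2
  rw [map_neg, map_div₀, Complex.conj_I, map_ofNat, neg_div, neg_neg]

/-- `|(g*)^(0)| = |ĝ(0)|` (evaluation at `0` is compatible with the involution up to conjugation).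
[cite: ConnesConsani2021, App. A p. 30] -/
theorem norm_mulFourier_weilReflect_zero (g : ℝ → ℂ) :
    ‖mulFourier (weilReflect g) 0‖ = ‖mulFourier g 0‖ := by
  rw [mulFourier_weilReflect, map_zero, Complex.norm_conj]

/-- The conclusion of eq. (4) / Theorem 6.11 for `g*` is the conclusion for `g` (both sides depend on
`g` only through `g ∗ g*` and `|ĝ(0)|`). [folklore] -/
private theorem fine_conclusion_weilReflect_iff (c : ℝ) (g : ℝ → ℂ) :
    (∀ (n : ℕ) (ξ : Fin n → Lp ℂ 2 (volume : Measure ℝ)),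
        Orthonormal ℂ ξ → (∀ i, ξ i ∈ soninSpace 1 1) →
          ∑ i, (soninTraceForm (weilConv (weilReflect g) (weilReflect (weilReflect g)))
                (ξ i : ℝ → ℂ)).re
              - c * ‖mulFourier (weilReflect g) 0‖ ^ 2
            ≤ (archW (weilConv (weilReflect g) (weilReflect (weilReflect g)))).re) ↔
    (∀ (n : ℕ) (ξ : Fin n → Lp ℂ 2 (volume : Measure ℝ)),
        Orthonormal ℂ ξ → (∀ i, ξ i ∈ soninSpace 1 1) →
          ∑ i, (soninTraceForm (weilConv g (weilReflect g)) (ξ i : ℝ → ℂ)).re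
              - c * ‖mulFourier g 0‖ ^ 2
            ≤ (archW (weilConv g (weilReflect g))).re) := by
  rw [weilConv_weilReflect_weilReflect, norm_mulFourier_weilReflect_zero]

/-- **The two printed forms of Connes–Consani 2021 eq. (4) / Theorem 6.11 are equivalent** (PROVED).
Left: the typed `WeilArchPositivity_soninTrace_fine` (Intro eq. (4) p. 4: vanishing at `i/2`).  Right:
the same statement with Theorem 6.11's hypothesis (§6.7 p. 28: vanishing at `−i/2`).  Proof: apply
either form to `g*` and use `(g*)^(± i/2) = conj ĝ(∓ i/2)`, `|(g*)^(0)| = |ĝ(0)|`, `g* ∗ (g*)* = g ∗ g*`,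
`tsupport g* = −tsupport g`, and that `g*` is again a test function.
[cite: ConnesConsani2021, eq. (4) p. 4; Thm. 6.11 §6.7 p. 28; App. A p. 30] -/
theorem weilArchPositivity_soninTrace_fine_iff_neg_I_half :
    WeilArchPositivity_soninTrace_fine ↔
      ∃ c : ℝ, c < 17 ∧
        ∀ g : ℝ → ℂ, IsWeilTest g →
          tsupport g ⊆ Icc (-(Real.log 2 / 2)) (Real.log 2 / 2) →
          mulFourier g (-(I / 2)) = 0 →
          ∀ (n : ℕ) (ξ : Fin n → Lp ℂ 2 (volume : Measure ℝ)),
            Orthonormal ℂ ξ → (∀ i, ξ i ∈ soninSpace 1 1) →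
              ∑ i, (soninTraceForm (weilConv g (weilReflect g)) (ξ i : ℝ → ℂ)).re
                  - c * ‖mulFourier g 0‖ ^ 2
                ≤ (archW (weilConv g (weilReflect g))).re := by
  constructor
  · rintro ⟨c, hc, H⟩
    refine ⟨c, hc, fun g hg hsupp h0 => ?_⟩
    have hvan : mulFourier (weilReflect g) (I / 2) = 0 := by
      rw [mulFourier_weilReflect_I_half, h0, map_zero]
    have key := H (weilReflect g) hg.weilReflect (tsupport_weilReflect_subset_Icc hsupp) hvan
    rwa [fine_conclusion_weilReflect_iff] at key
  · rintro ⟨c, hc, H⟩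
    refine ⟨c, hc, fun g hg hsupp h1 => ?_⟩
    have hvan : mulFourier (weilReflect g) (-(I / 2)) = 0 := by
      rw [mulFourier_weilReflect_neg_I_half, h1, map_zero]
    have key := H (weilReflect g) hg.weilReflect (tsupport_weilReflect_subset_Icc hsupp) hvan
    rwa [fine_conclusion_weilReflect_iff] at key

/-- Likewise for Theorem 1: the form with vanishing at `−i/2` and `0` is equivalent to the typed one
(vanishing at `i/2` and `0`), since `(g*)^(0) = conj ĝ(0)`. [cite: ConnesConsani2021, Thm. 1 p. 4] -/
theorem weilArchPositivity_soninTrace_iff_neg_I_half :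
    WeilArchPositivity_soninTrace ↔
      ∀ g : ℝ → ℂ, IsWeilTest g →
        tsupport g ⊆ Icc (-(Real.log 2 / 2)) (Real.log 2 / 2) →
        mulFourier g (-(I / 2)) = 0 → mulFourier g 0 = 0 →
        ∀ (n : ℕ) (ξ : Fin n → Lp ℂ 2 (volume : Measure ℝ)),
          Orthonormal ℂ ξ → (∀ i, ξ i ∈ soninSpace 1 1) →
            ∑ i, (soninTraceForm (weilConv g (weilReflect g)) (ξ i : ℝ → ℂ)).re
              ≤ (archW (weilConv g (weilReflect g))).re := by
  have h0iff : ∀ g : ℝ → ℂ, mulFourier (weilReflect g) 0 = 0 ↔ mulFourier g 0 = 0 := fun g => by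
    rw [mulFourier_weilReflect, map_zero, map_eq_zero]
  constructor
  · intro H g hg hsupp h1 h0 n ξ hξ hS
    have hvan : mulFourier (weilReflect g) (I / 2) = 0 := by
      rw [mulFourier_weilReflect_I_half, h1, map_zero]
    have key := H (weilReflect g) hg.weilReflect (tsupport_weilReflect_subset_Icc hsupp) hvan
      ((h0iff g).2 h0) n ξ hξ hS
    rwa [weilConv_weilReflect_weilReflect] at key
  · intro H g hg hsupp h1 h0 n ξ hξ hS
    have hvan : mulFourier (weilReflect g) (-(I / 2)) = 0 := by
      rw [mulFourier_weilReflect_neg_I_half, h1, map_zero]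
    have key := H (weilReflect g) hg.weilReflect (tsupport_weilReflect_subset_Icc hsupp) hvan
      ((h0iff g).2 h0) n ξ hξ hS
    rwa [weilConv_weilReflect_weilReflect] at key

end Literature.NumberTheory.ConnesConsani2021

end
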